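import Literature.NumberTheory.Automorphic.Liu2021.AppendixC.HeckeImageSemisimple
import Literature.NumberTheory.Automorphic.Liu2021.AppendixC.EtaleFaltingsTower
import Literature.NumberTheory.Automorphic.HeckeFixedVectorsSemisimple
import Literature.LinearAlgebra.BaseChange.FixedPointsBaseChange
import Literature.RingTheory.SimpleModule.SemisimpleOfFaithfulModule
import Literature.RingTheory.SimpleModule.SemisimpleBaseChangeDescent
import Literature.Algebra.Lie.CentroidScalarExtension
import HarnessLib

/-!
# [Liu 2021, p. 133 (D.3)] `G`-level semisimplicity of `ℚ̄_ℓ ⊗ H¹_ét(A_∞)` ⇒ `H¹_ét(A_K)` is a semisimple Hecke module at every small level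
# (the level-wise «S1c» semisimplicity as a THEOREM of the `G`-level sentence)

Topic `NumberTheory/Automorphic/Liu2021/AppendixC`; namespace `Literature.NumberTheory.Automorphic.Liu2021.AppendixC.Sec42Data.HeckeTranslates`.
THEOREMS ONLY (no definition, no named fact, no instance, no `sorry`).  Print, [Liu2021] p. 133 (D.3): «`H¹_B(A_K^st, ℂ) ≃ ⊕_{π^∞} H¹_B(Sh(G,h)_K,
ℂ)[(π^∞)^K]` … of `C_c^∞(K\G(𝔸^∞)/K, ℚ)`-modules» — the tower's first cohomology is a SEMISIMPLE `G(𝔸^∞)`-module, and its level-`K` part is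
accordingly a semisimple module over the level-`K` Hecke algebra.  This file derives the second (level-wise) statement from the first (`G`-level) one
for the tree's étale tower `C.etaleH1Tower ℓ` with its Hecke action `T.etHeckeRep ℓ` (★ `EtaleHeckeDatumOfTranslates`), in EXACTLY the currency
consumed by ★ DH2b `isSemisimpleRing_heckeImage_of_isSemisimpleModule` (`IsSemisimpleModule ↥(Algebra.adjoin ℚ_[ℓ] (range fun g => ᵗV_ℓ^ℚ(heckeEnd K g)))
(C.etaleH1 ℓ K)`).  The `G`-level input is an EXPLICIT BINDER: a `ℚ̄_ℓ`-representation `σ` on `ℚ̄_ℓ ⊗ H¹_ét(A_∞)` with `σ g = (T.etHeckeRep ℓ g) ⊗ 1`,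
assumed semisimple (Mathlib `Representation.IsSemisimpleRepresentation`); nothing is defined.

* §1 `range_toTower_baseChange_eq_fixedPoints` — below the level-compatibility threshold (injective pull-backs `hI`, descent up to isogeny `hD`):
  `range ([·]_K ⊗ 1) = (ℚ̄_ℓ ⊗ H¹_ét(A_∞))^K` (★ `range_toTower_eq_of_isogenyDescent` + ★ `FixedPointsBaseChange`, [Milne2017] Cor. 4.34);
  `toTower_baseChange_ops_eq_heckeOperator` (`[·]_K ⊗ 1` intertwines `ᵗV_ℓ^ℚ(heckeEnd g) ⊗ 1` with `[KgK]_σ`).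
* §2 **`exists_stable_isCompl_baseChange_etaleH1`** — `σ` semisimple ⇒ every subspace of `ℚ̄_ℓ ⊗ H¹_ét(A_K)` stable under the realised Hecke
  endomorphisms has a stable complement (★ `HeckeFixedVectorsSemisimple.exists_heckeStable_compl` transported along the injective `[·]_K ⊗ 1`);
  `isSemisimpleModule_adjoin_baseChange_etaleH1` (★ packaging over `Algebra.adjoin`).
* §3 DESCENT `ℚ̄_ℓ → ℚ_ℓ`: `baseChange_mem_adjoin`, `isSemisimpleRing_adjoin_dualMap_rationalTateAction_heckeEnd` (`ℚ̄_ℓ ⊗_{ℚ_ℓ} ℚ_ℓ[ops] ≅ ℚ̄_ℓ[ops ⊗ 1]`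
  by ★ `tensorProductEnd_bijective`, faithful semisimple module ⇒ semisimple ring by ★ Lam (9.11), then ★ `isSemisimpleRing_of_isSemisimpleRing_baseChange`
  [Pierce1982]), and the two heads **`isSemisimpleModule_etaleH1_of_isSemisimpleRepresentation`** (= DH2b's hypothesis `hss` token for token) and
  **`isSemisimpleRing_heckeImage_of_isSemisimpleRepresentation`** (★ DH2b applied: `heckeImage K` is a semisimple ring).

Cell note (hodgecm-mathlib, crux `HLiu418` = stmt-HodgeConjecture-24832, d6 line): this is «the level-wise form `S1cShape` as a THEOREM of the `G`-level S1c
fact» (A-plan1 (g13) 2026-08-30 (Q2)); count-neutral; HC_CM is proved only modulo the 7 printed citations until rung 0 closes.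

## References
* [Liu2021] Y. Liu, *Fourier–Jacobi cycles and arithmetic relative trace formula*, Camb. J. Math. 9 (2021), p. 133 (D.3) (FJcycle.tex l. 5463–5470),
  §4.2–4.3 (l. 2154–2166).
* [BushnellHenniart2006] C. J. Bushnell, G. Henniart, *The Local Langlands Conjecture for GL(2)* (2006), §4.2 Lemma (p. 35), §4.3.
* [Milne2017] J. S. Milne, *Algebraic Groups* (CUP 2017), Cor. 4.34.
* [Lam2001FirstCourse] T. Y. Lam, *A First Course in Noncommutative Rings* (2001), §9 Prop. (9.11) p. 146.
* [Pierce1982] R. S. Pierce, *Associative Algebras* (1982), §10.6 Corollary (p. 189), §10.7 Corollary b (p. 191).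
-/

set_option autoImplicit false

noncomputable section

open CategoryTheory NumberField Function MulAction
open scoped TensorProduct

namespace Literature.NumberTheory.Automorphic.Liu2021.AppendixC

open Literature.AlgebraicGeometry.Motives (AbelianVariety)
open Literature.AlgebraicGeometry.Motives.AbelianVariety (rationalTateModuleMap endAlgebra rationalTateAction)

variable {F E : Type} [Field F] [NumberField F] [IsTotallyReal F] [Field E] [NumberField E] [Algebra F E]
  [IsTotallyComplex E] [Algebra.IsQuadraticExtension F E]
variable {P5 : PropC5Data F E} {isotropicAt : ℕ → Prop}

namespace Sec42Data.HeckeTranslates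

variable {C : Sec42Data P5 isotropicAt} (T : C.HeckeTranslates) (ℓ : ℕ) [Fact ℓ.Prime]
variable (K : C5.SmallLevel C.S.K₀)
  (hI : ∀ ⦃K K' : C5.SmallLevel C.S.K₀⦄ (f : K' ⟶ K), Function.Injective (rationalTateModuleMap ℓ (C.Atr f)).dualMap)
  (σ : Representation (AlgebraicClosure ℚ_[ℓ]) C.G (AlgebraicClosure ℚ_[ℓ] ⊗[ℚ_[ℓ]] C.etaleH1Tower ℓ))
  (hσ : ∀ g : C.G, σ g = (T.etHeckeRep ℓ g).baseChange (AlgebraicClosure ℚ_[ℓ]))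

/-- `ℓ ≠ 0` in a number field. [folklore] -/
private theorem natCast_ne_zero'' {L : Type*} [Field L] [NumberField L] : (ℓ : L) ≠ 0 := Nat.cast_ne_zero.2 (Fact.out : ℓ.Prime).ne_zero

/-- The double cosets of a small level are finite unions of left cosets (`K` compact open). [cite: BushnellHenniart2006, §4.2 Lemma (p. 35)] -/
theorem finite_orbit_smallLevel' (g : C.G) : (orbit (K.1.1 : Subgroup C.G) (g : C.G ⧸ (K.1.1 : Subgroup C.G))).Finite := by
  haveI := Literature.NumberTheory.Automorphic.isHeckeTriple_top_of_isCompact_isOpen (K.1.1 : Subgroup C.G) K.1.2.2 K.1.2.1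
  exact Literature.NumberTheory.Automorphic.finite_orbit_quotient (K.1.1 : Subgroup C.G) g

/-! ## §1 `[·]_K ⊗ 1` identifies `ℚ̄_ℓ ⊗ H¹_ét(A_K)` with the `K`-fixed vectors of `σ = 1 ⊗ rhoEt`, compatibly with the Hecke operators -/

set_option maxHeartbeats 400000 in
include hσ in
/-- The Hecke operators of `σ = 1 ⊗ rhoEt` are the base changes of those of `rhoEt` (finite double cosets). [cite: Liu2021, §4.2 (FJcycle.tex l. 2160–2166)] -/
theorem heckeOperator_sigma_eq_baseChange (Kg : Subgroup C.G) (g : C.G) (hfin : (orbit Kg (g : C.G ⧸ Kg)).Finite)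
    (y : AlgebraicClosure ℚ_[ℓ] ⊗[ℚ_[ℓ]] C.etaleH1Tower ℓ) :
    heckeOperator σ Kg g y = (heckeOperator (T.etHeckeRep ℓ) Kg g).baseChange (AlgebraicClosure ℚ_[ℓ]) y := by
  classical
  rw [heckeOperator, heckeOperator, finsum_mem_eq_finite_toFinset_sum _ hfin, finsum_mem_eq_finite_toFinset_sum _ hfin,
    LinearMap.sum_apply]
  induction hfin.toFinset using Finset.induction_on with
  | empty => simp
  | insert a s ha ih => rw [Finset.sum_insert ha, Finset.sum_insert ha, LinearMap.baseChange_add, LinearMap.add_apply, ih, hσ]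

include hσ in
/-- **`[·]_K ⊗ 1` intertwines the realised Hecke endomorphism `ᵗV_ℓ^ℚ(heckeEnd K g) ⊗ 1` on `ℚ̄_ℓ ⊗ H¹_ét(A_K)` with the Hecke operator `[KgK]_σ`**
(★ `toTower_baseChange_dualMap_rationalTateAction_heckeEnd`). [cite: Liu2021, §4.2 (FJcycle.tex l. 2154–2160)] -/
theorem toTower_baseChange_ops_eq_heckeOperator (hD : T.IsogenyDescent) (g : C.G) (x : AlgebraicClosure ℚ_[ℓ] ⊗[ℚ_[ℓ]] C.etaleH1 ℓ K) :
    (C.toTower ℓ K).baseChange (AlgebraicClosure ℚ_[ℓ]) (((rationalTateAction (C.A K) ℓ (T.heckeEnd hD K g)).dualMap).baseChange (AlgebraicClosure ℚ_[ℓ]) x) =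
      heckeOperator σ (K.1.1 : Subgroup C.G) g ((C.toTower ℓ K).baseChange (AlgebraicClosure ℚ_[ℓ]) x) := by
  rw [T.toTower_baseChange_dualMap_rationalTateAction_heckeEnd ℓ hD K g (AlgebraicClosure ℚ_[ℓ]) x,
    T.heckeOperator_sigma_eq_baseChange ℓ σ hσ _ g (finite_orbit_smallLevel' K g)]

include hI hσ in
/-- **`range ([·]_K ⊗ 1) = (ℚ̄_ℓ ⊗ H¹_ét(A_∞))^K`** below the level-compatibility threshold: the `K`-invariants of the tower are the level-`K` classes
(★ `range_toTower_eq_of_isogenyDescent`) and the formation of invariants commutes with `ℚ̄_ℓ/ℚ_ℓ` (★ `FixedPointsBaseChange`).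
[cite: Liu2021, Thm. 4.18 (1) (FJcycle.tex l. 2239) and §4.2 (l. 2158–2166)] [cite: Milne2017, Cor. 4.34] -/
theorem range_toTower_baseChange_eq_fixedPoints (hD : T.IsogenyDescent) :
    LinearMap.range ((C.toTower ℓ K).baseChange (AlgebraicClosure ℚ_[ℓ])) = σ.fixedPoints (K.1.1 : Subgroup C.G) := by
  have hrange := T.range_toTower_eq_of_isogenyDescent ℓ hI hD K
  refine le_antisymm ?_ ?_
  · rintro _ ⟨x, rfl⟩
    rw [Representation.mem_fixedPoints]
    intro k hk
    have hfix : (T.etHeckeRep ℓ k) ∘ₗ C.toTower ℓ K = C.toTower ℓ K := by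
      apply LinearMap.ext
      intro φ
      have : C.toTower ℓ K φ ∈ Set.range (C.toTower ℓ K) := ⟨φ, rfl⟩
      rw [hrange] at this
      exact this k hk
    rw [hσ, ← LinearMap.comp_apply, ← LinearMap.baseChange_comp, hfix]
  · intro y hy
    rw [Representation.mem_fixedPoints] at hy
    have hfix : ∀ k : (K.1.1 : Subgroup C.G),
        ((T.etHeckeRep ℓ (k : C.G) : C.etaleH1Tower ℓ →ₗ[ℚ_[ℓ]] C.etaleH1Tower ℓ)).lTensor (AlgebraicClosure ℚ_[ℓ]) y = y := by
      intro k
      have h := hy k k.2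
      rw [hσ] at h
      exact (congrFun ((T.etHeckeRep ℓ (k : C.G) : C.etaleH1Tower ℓ →ₗ[ℚ_[ℓ]] C.etaleH1Tower ℓ).baseChange_eq_ltensor
        (A := (AlgebraicClosure ℚ_[ℓ]))) y).symm.trans h
    have hP : ∀ x : C.etaleH1Tower ℓ, (∀ k : (K.1.1 : Subgroup C.G), (T.etHeckeRep ℓ (k : C.G) : C.etaleH1Tower ℓ →ₗ[ℚ_[ℓ]] C.etaleH1Tower ℓ) x = x) →
        x ∈ LinearMap.range (C.toTower ℓ K) := by
      intro x hx
      have hx' : x ∈ Set.range (C.toTower ℓ K) := by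
        rw [hrange]
        exact fun k hk => hx ⟨k, hk⟩
      obtain ⟨z, hz⟩ := hx'
      exact ⟨z, hz⟩
    have hmem := Literature.LinearAlgebra.BaseChange.mem_range_lTensor_subtype_of_lTensor_fixed (A := (AlgebraicClosure ℚ_[ℓ]))
      (fun k : (K.1.1 : Subgroup C.G) => (T.etHeckeRep ℓ (k : C.G) : C.etaleH1Tower ℓ →ₗ[ℚ_[ℓ]] C.etaleH1Tower ℓ))
      (LinearMap.range (C.toTower ℓ K)) hP hfix
    obtain ⟨z, hz⟩ := hmem
    obtain ⟨w, rfl⟩ := (LinearMap.lTensor_surjective (AlgebraicClosure ℚ_[ℓ]) (LinearMap.surjective_rangeRestrict (C.toTower ℓ K))) z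
    refine ⟨w, ?_⟩
    have hcomp : (LinearMap.range (C.toTower ℓ K)).subtype ∘ₗ (C.toTower ℓ K).rangeRestrict = C.toTower ℓ K := LinearMap.ext fun _ => rfl
    rw [← hz, ← LinearMap.comp_apply, ← LinearMap.lTensor_comp, hcomp]
    exact congrFun ((C.toTower ℓ K).baseChange_eq_ltensor (A := AlgebraicClosure ℚ_[ℓ])) w

/-! ## §2 Stable complements in `ℚ̄_ℓ ⊗ H¹_ét(A_K)` from the semisimplicity of `σ` -/

include hI hσ in
/-- **`σ` semisimple ⇒ every Hecke-stable subspace of `ℚ̄_ℓ ⊗ H¹_ét(A_K)` has a Hecke-stable complement** («`V ↦ V^K` carries a `G`-decomposition to a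
Hecke decomposition», [BushnellHenniart2006] §4.2–4.3; transported along the injective `[·]_K ⊗ 1` onto `(ℚ̄_ℓ ⊗ H¹_ét(A_∞))^K`).  Here «Hecke-stable» = stable under
every `ᵗV_ℓ^ℚ(heckeEnd K g) ⊗ 1`. [cite: Liu2021, p. 133 (D.3)] [cite: BushnellHenniart2006, §4.2 Lemma (p. 35)] -/
theorem exists_stable_isCompl_baseChange_etaleH1 (hD : T.IsogenyDescent) [σ.IsSemisimpleRepresentation]
    (N : Submodule (AlgebraicClosure ℚ_[ℓ]) (AlgebraicClosure ℚ_[ℓ] ⊗[ℚ_[ℓ]] C.etaleH1 ℓ K))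
    (hN : ∀ s ∈ Set.range (fun g : C.G => ((rationalTateAction (C.A K) ℓ (T.heckeEnd hD K g)).dualMap).baseChange (AlgebraicClosure ℚ_[ℓ])),
      ∀ n ∈ N, s n ∈ N) :
    ∃ N' : Submodule (AlgebraicClosure ℚ_[ℓ]) (AlgebraicClosure ℚ_[ℓ] ⊗[ℚ_[ℓ]] C.etaleH1 ℓ K),
      (∀ s ∈ Set.range (fun g : C.G => ((rationalTateAction (C.A K) ℓ (T.heckeEnd hD K g)).dualMap).baseChange (AlgebraicClosure ℚ_[ℓ])),
        ∀ n ∈ N', s n ∈ N') ∧ IsCompl N N' := by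
  set j := (C.toTower ℓ K).baseChange (AlgebraicClosure ℚ_[ℓ]) with hj
  have hjinj : Function.Injective j := toTower_baseChange_injective C ℓ (C.toTower_injective ℓ hI K)
  have hjK : LinearMap.range j = σ.fixedPoints (K.1.1 : Subgroup C.G) := T.range_toTower_baseChange_eq_fixedPoints ℓ K hI σ hσ hD
  have hfin : ∀ g : C.G, (orbit (K.1.1 : Subgroup C.G) (g : C.G ⧸ (K.1.1 : Subgroup C.G))).Finite := fun g => finite_orbit_smallLevel' K g
  -- the image `N.map j ≤ V^K` is Hecke-stable
  have hNK : N.map j ≤ σ.fixedPoints (K.1.1 : Subgroup C.G) := by rw [← hjK]; exact LinearMap.map_le_range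
  have hNst : ∀ g : C.G, ∀ n ∈ N.map j, heckeOperator σ (K.1.1 : Subgroup C.G) g n ∈ N.map j := by
    rintro g _ ⟨x, hx, rfl⟩
    refine ⟨_, hN _ ⟨g, rfl⟩ x hx, ?_⟩
    exact T.toTower_baseChange_ops_eq_heckeOperator ℓ K σ hσ hD g x
  obtain ⟨Cc, hCK, hCst, hdisj, hsup⟩ := exists_heckeStable_compl σ (K.1.1 : Subgroup C.G) hfin hNK hNst
  refine ⟨Cc.comap j, ?_, ?_, ?_⟩
  · rintro _ ⟨g, rfl⟩ x hx
    rw [Submodule.mem_comap] at hx ⊢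
    change j ((((rationalTateAction (C.A K) ℓ (T.heckeEnd hD K g)).dualMap).baseChange (AlgebraicClosure ℚ_[ℓ])) x) ∈ Cc
    rw [hj, T.toTower_baseChange_ops_eq_heckeOperator ℓ K σ hσ hD g x]
    exact hCst g _ hx
  · rw [disjoint_iff, eq_bot_iff]
    rintro x ⟨hxN, hxC⟩
    have hxC' : j x ∈ Cc := hxC
    have : j x ∈ N.map j ⊓ Cc := ⟨⟨x, hxN, rfl⟩, hxC'⟩
    rw [hdisj, Submodule.mem_bot] at this
    rw [Submodule.mem_bot]
    exact hjinj (by rw [this, map_zero])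
  · rw [codisjoint_iff, eq_top_iff]
    intro x _
    have hx : j x ∈ N.map j ⊔ Cc := by rw [hsup, ← hjK]; exact ⟨x, rfl⟩
    obtain ⟨a, ha, b, hb, hab⟩ := Submodule.mem_sup.1 hx
    obtain ⟨a₀, ha₀, rfl⟩ := ha
    have hb' : b = j (x - a₀) := by rw [map_sub, ← hab, add_sub_cancel_left]
    rw [show x = a₀ + (x - a₀) by abel]
    refine Submodule.add_mem_sup ha₀ ?_
    rw [Submodule.mem_comap, ← hb']
    exact hb

include hI hσ in
/-- `σ` semisimple ⇒ `ℚ̄_ℓ ⊗ H¹_ét(A_K)` is a semisimple module over `ℚ̄_ℓ[ᵗV_ℓ^ℚ(heckeEnd K g) ⊗ 1 : g]` (★ packaging `isSemisimpleModule_adjoin_of_forall_exists_isCompl`).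
[cite: Liu2021, p. 133 (D.3)] [cite: BushnellHenniart2006, §4.3] -/
theorem isSemisimpleModule_adjoin_baseChange_etaleH1 (hD : T.IsogenyDescent) [σ.IsSemisimpleRepresentation] :
    IsSemisimpleModule
      ↥(Algebra.adjoin (AlgebraicClosure ℚ_[ℓ])
        ((Set.range (fun g : C.G => ((rationalTateAction (C.A K) ℓ (T.heckeEnd hD K g)).dualMap).baseChange (AlgebraicClosure ℚ_[ℓ]))) :
          Set (Module.End (AlgebraicClosure ℚ_[ℓ]) (AlgebraicClosure ℚ_[ℓ] ⊗[ℚ_[ℓ]] C.etaleH1 ℓ K))))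
      (AlgebraicClosure ℚ_[ℓ] ⊗[ℚ_[ℓ]] C.etaleH1 ℓ K) :=
  isSemisimpleModule_adjoin_of_forall_exists_isCompl _ fun N hN => T.exists_stable_isCompl_baseChange_etaleH1 ℓ K hI σ hσ hD N hN

/-! ## §3 Descent to `ℚ_ℓ`: the level-`K` Hecke module `H¹_ét(A_K)` is semisimple -/

/-- Base change carries the `ℚ_ℓ`-algebra generated by operators `S` into the `ℚ̄_ℓ`-algebra generated by their base changes. [folklore] -/
private theorem baseChange_mem_adjoin {M : Type*} [AddCommGroup M] [Module ℚ_[ℓ] M] (S : Set (Module.End ℚ_[ℓ] M)) {s : Module.End ℚ_[ℓ] M}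
    (hs : s ∈ Algebra.adjoin ℚ_[ℓ] S) :
    s.baseChange (AlgebraicClosure ℚ_[ℓ]) ∈ Algebra.adjoin (AlgebraicClosure ℚ_[ℓ]) ((fun t : Module.End ℚ_[ℓ] M => t.baseChange (AlgebraicClosure ℚ_[ℓ])) '' S) := by
  induction hs using Algebra.adjoin_induction with
  | mem x hx => exact Algebra.subset_adjoin ⟨x, hx, rfl⟩
  | algebraMap c =>
    rw [Algebra.algebraMap_eq_smul_one, LinearMap.baseChange_smul, Module.End.one_eq_id, LinearMap.baseChange_id,
      ← Module.End.one_eq_id, ← algebraMap_smul (AlgebraicClosure ℚ_[ℓ]) c, ← Algebra.algebraMap_eq_smul_one]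
    exact Subalgebra.algebraMap_mem _ _
  | add x y _ _ hx hy => rw [LinearMap.baseChange_add]; exact add_mem hx hy
  | mul x y _ _ hx hy => rw [Module.End.mul_eq_comp, LinearMap.baseChange_comp, ← Module.End.mul_eq_comp]; exact mul_mem hx hy

include hI hσ in
/-- **The `ℚ_ℓ`-algebra `ℚ_ℓ[ᵗV_ℓ^ℚ(heckeEnd K g) : g] ⊆ End(H¹_ét(A_K))` is a semisimple ring** when `σ` is semisimple: `ℚ̄_ℓ ⊗_{ℚ_ℓ} ℚ_ℓ[ops] ≅ ℚ̄_ℓ[ops ⊗ 1]`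
(`K ⊗_k End_k M ≅ End_K(K ⊗ M)`, ★ `tensorProductEnd_bijective`), the latter acts faithfully on the semisimple finite-dimensional module `ℚ̄_ℓ ⊗ H¹_ét(A_K)`
hence is semisimple ([Lam2001FirstCourse] (9.11)), and semisimplicity descends along `ℚ_ℓ → ℚ̄_ℓ` ([Pierce1982] §10.7).
[cite: Liu2021, p. 133 (D.3)] [cite: Lam2001FirstCourse, §9 Prop. (9.11) p. 146] [cite: Pierce1982, §10.6 Corollary (p. 189) and §10.7 Corollary b (p. 191)] -/
theorem isSemisimpleRing_adjoin_dualMap_rationalTateAction_heckeEnd (hD : T.IsogenyDescent) [σ.IsSemisimpleRepresentation] :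
    IsSemisimpleRing ↥(Algebra.adjoin ℚ_[ℓ] (Set.range fun g : C.G => (rationalTateAction (C.A K) ℓ (T.heckeEnd hD K g)).dualMap)) := by
  classical
  set M := C.etaleH1 ℓ K with hM
  set L := AlgebraicClosure ℚ_[ℓ] with hL
  set S : Set (Module.End ℚ_[ℓ] M) := Set.range fun g : C.G => (rationalTateAction (C.A K) ℓ (T.heckeEnd hD K g)).dualMap with hS
  set St : Subalgebra ℚ_[ℓ] (Module.End ℚ_[ℓ] M) := Algebra.adjoin ℚ_[ℓ] S with hSt
  set S' : Set (Module.End L (L ⊗[ℚ_[ℓ]] M)) :=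
    Set.range (fun g : C.G => ((rationalTateAction (C.A K) ℓ (T.heckeEnd hD K g)).dualMap).baseChange L) with hS'
  set St' : Subalgebra L (Module.End L (L ⊗[ℚ_[ℓ]] M)) := Algebra.adjoin L S' with hSt'
  -- finiteness
  have hℓE : (ℓ : E) ≠ 0 := natCast_ne_zero'' ℓ
  haveI : Module.Finite ℚ_[ℓ] ((C.A K).rationalTateModule ℓ) := by
    haveI := Literature.AlgebraicGeometry.Motives.AbelianVariety.module_finite_tateModule_of_cast_ne_zero (C.A K) ℓ hℓE
    change Module.Finite ℚ_[ℓ] (ℚ_[ℓ] ⊗[ℤ_[ℓ]] (C.A K).tateModule ℓ)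
    infer_instance
  haveI : Module.Finite ℚ_[ℓ] M := by
    change Module.Finite ℚ_[ℓ] (Module.Dual ℚ_[ℓ] ((C.A K).rationalTateModule ℓ))
    infer_instance
  haveI : Module.Finite ℚ_[ℓ] ↥St := Module.Finite.of_injective St.val.toLinearMap Subtype.val_injective
  -- `S'` is the image of `S` under base change
  have hSS' : S' = (fun t : Module.End ℚ_[ℓ] M => t.baseChange L) '' S := by
    rw [hS', hS, ← Set.range_comp]
    rfl
  -- the semisimple module over `St'`
  haveI hss' : IsSemisimpleModule ↥St' (L ⊗[ℚ_[ℓ]] M) := T.isSemisimpleModule_adjoin_baseChange_etaleH1 ℓ K hI σ hσ hD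
  -- the realisation `θ : L ⊗_{ℚ_ℓ} St → End_L (L ⊗ M)`, `c ⊗ s ↦ c • s_L`
  let θ : L ⊗[ℚ_[ℓ]] ↥St →ₐ[L] Module.End L (L ⊗[ℚ_[ℓ]] M) :=
    (LinearMap.tensorProductEnd ℚ_[ℓ] L M).comp (Algebra.TensorProduct.map (AlgHom.id L L) St.val)
  have hθ : ∀ (c : L) (s : ↥St), θ (c ⊗ₜ[ℚ_[ℓ]] s) = c • (s : Module.End ℚ_[ℓ] M).baseChange L := by
    intro c s
    change LinearMap.tensorProductEnd ℚ_[ℓ] L M (Algebra.TensorProduct.map (AlgHom.id L L) St.val (c ⊗ₜ[ℚ_[ℓ]] s)) = _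
    rw [Algebra.TensorProduct.map_tmul, AlgHom.id_apply, Literature.Algebra.Lie.CentroidScalarExtension.tensorProductEnd_tmul]
    rfl
  -- `θ` is injective: `1 ⊗ St.val` is injective (flatness over a field) and `tensorProductEnd` is bijective
  have hinj : Function.Injective θ := by
    have h1 : Function.Injective (Algebra.TensorProduct.map (AlgHom.id L L) St.val) := by
      have := Module.Flat.lTensor_preserves_injective_linearMap (M := L) St.val.toLinearMap Subtype.val_injective
      intro a b hab
      apply this
      exact hab
    exact (Literature.Algebra.Lie.CentroidScalarExtension.tensorProductEnd_bijective (k := ℚ_[ℓ]) L (V := M)).1.comp h1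
  -- the range of `θ` is `St'`
  have hrange : θ.range = St' := by
    refine le_antisymm ?_ ?_
    · intro y hy
      obtain ⟨z, rfl⟩ := (AlgHom.mem_range θ).1 hy
      clear hy
      induction z using TensorProduct.induction_on with
      | zero => rw [map_zero]; exact St'.zero_mem
      | tmul c s =>
        rw [hθ]
        refine Subalgebra.smul_mem _ ?_ c
        rw [hSt', hSS']
        exact baseChange_mem_adjoin ℓ S s.2
      | add z w hz hw => rw [map_add]; exact St'.add_mem hz hw
    · refine Algebra.adjoin_le ?_
      rintro _ ⟨g, rfl⟩
      refine (AlgHom.mem_range θ).2 ⟨(1 : L) ⊗ₜ[ℚ_[ℓ]] ⟨(rationalTateAction (C.A K) ℓ (T.heckeEnd hD K g)).dualMap, Algebra.subset_adjoin ⟨g, rfl⟩⟩, ?_⟩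
      rw [hθ, one_smul]
  -- `L ⊗ St` is semisimple (faithful semisimple module), hence so is `St`
  haveI : IsSemisimpleModule ↥θ.range (L ⊗[ℚ_[ℓ]] M) := by rw [hrange]; exact hss'
  haveI : IsSemisimpleRing (L ⊗[ℚ_[ℓ]] ↥St) :=
    Literature.RingTheory.SimpleModule.isSemisimpleRing_of_injective_of_isSemisimpleModule θ hinj
  exact Literature.RingTheory.SimpleModule.isSemisimpleRing_of_isSemisimpleRing_baseChange ℚ_[ℓ] (↥St) L

include hI hσ in
/-- **`H¹_ét(A_K)` IS A SEMISIMPLE HECKE MODULE when `ℚ̄_ℓ ⊗ H¹_ét(A_∞)` is a semisimple `𝔾(𝔸_F^∞)`-module** — the level-wise «S1c» semisimplicity, in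
EXACTLY the currency of ★ DH2b `isSemisimpleRing_heckeImage_of_isSemisimpleModule` (hypothesis `hss`), as a theorem of the `G`-level (D.3) sentence.
[cite: Liu2021, p. 133 (D.3)] [cite: BushnellHenniart2006, §4.3] -/
theorem isSemisimpleModule_etaleH1_of_isSemisimpleRepresentation (hD : T.IsogenyDescent) [σ.IsSemisimpleRepresentation] :
    IsSemisimpleModule
      ↥(Algebra.adjoin ℚ_[ℓ] (Set.range fun g : C.G => (rationalTateAction (C.A K) ℓ (T.heckeEnd hD K g)).dualMap))
      (C.etaleH1 ℓ K) := by
  haveI := T.isSemisimpleRing_adjoin_dualMap_rationalTateAction_heckeEnd ℓ K hI σ hσ hD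
  infer_instance

include hI hσ in
/-- **The image of the Hecke algebra in `End⁰(A_K)` is semisimple when `ℚ̄_ℓ ⊗ H¹_ét(A_∞)` is a semisimple `𝔾(𝔸_F^∞)`-module** (★ DH2b composed with the
previous theorem). [cite: Liu2021, p. 133 (D.3)] [cite: Lam2001FirstCourse, §9 Prop. (9.11) p. 146] -/
theorem isSemisimpleRing_heckeImage_of_isSemisimpleRepresentation (hD : T.IsogenyDescent) [σ.IsSemisimpleRepresentation] :
    IsSemisimpleRing ↥(T.heckeImage hD K) :=
  T.isSemisimpleRing_heckeImage_of_isSemisimpleModule ℓ hD K (T.isSemisimpleModule_etaleH1_of_isSemisimpleRepresentation ℓ K hI σ hσ hD)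

end Sec42Data.HeckeTranslates

end Literature.NumberTheory.Automorphic.Liu2021.AppendixC
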